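import Summits.QuantumFields.YangMills.Theorems.BalabanUVNodesN07DirectMethodInduction
import Summits.QuantumFields.YangMills.Theorems.BalabanUVNodesN07AtRecordCritPinned

/-!
# BalabanUVNodes ∕ N07 ([Balaban1985Variational] Theorem 1 p. 279) — THE EXISTENCE SIDE OF THEOREM 1 FROM PRINT's PROPOSITION 8 AND BOUNDARY
# AVOIDANCE, BY THE DIRECT METHOD: Proposition 7's existence sentence («there exists a minimal orbit in the space (6) with ε₀ = O(1)C₁B₃ε₁»,
# the GLOBAL-minimum reading of record, cell DIVERGENCE D-B11-2) is DERIVED at NODE 00's objects from compactness + ONE soft displayed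
# sentence; hence THEOREM 1 over the whole family of record ⇐ Prop. 7's UNIQUENESS sentence + Prop. 8 + Sect. F + boundary avoidance

Track A of `YM-PLAN.md` (cell `pub-ymgap`, HUMAN RULING D-0062), DAG node **N07** = [Balaban1985Variational] T. Bałaban, *The variational problem
and background fields in renormalization group method for lattice gauge theories*, Commun. Math. Phys. **102** (1985) 277–309; seat
`pub-ymgap-dag-n07-e` (generation 5; module 12, companion of `…N07DirectMethod` ∕ `…N07DirectMethodInduction` (p487790 ∕ p488364) and of the
crit-pinned closers `…N07AtRecordCritPinned` (p465289); `--supports stmt-QuantumFields-19903 --as helper`).  THEOREMS ONLY (0 `def`, 0 `sorry`).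

WHY.  Every N07 closer of record in print's Prop-7 DAG currency displays `p7 : B11.Prop7Printed B₃ C₁ (famXOfRecord F N ζ⋆)` — Proposition 7
p. 299: (first sentence) «for ε₀ ≤ a₀ and B₃ε₁ ≤ ε₀ the variational problem (5), (6) has at most one critical orbit» AND (second sentence) «if ε₁ ≤ a′₁,
then there exists a minimal orbit in the space (6) with ε₀ = O(1)C₁B₃ε₁», the latter typed in the reading of record D-n07a-2 («minimal» = minimiser of
(5) over `𝔘_k(e) ∩ 𝔅_k(V)`, `Setup.IsBackground`) which print's own argument ((142): a positive second differential, a STRICT LOCAL minimum) does NOT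
deliver (cell DIVERGENCE D-B11-2 ∕ GAPS G-B11-E5R, `B11GlobalMin`).  This module DERIVES the second sentence at NODE 00's objects, level by level,
from three things: (i) the DIRECT METHOD (companion: the Wilson action attains its minimum on every CLOSED small-field class of the fibre);
(ii) print's PROPOSITION 8 p. 304 («if U is a critical configuration of (5) in the space (6) … and if ε₀ ≤ a₅, then U belongs to the space (8)»,
proved in print, Sect. F) — used ONLY through interior minimisers, which ARE critical (this lineage's Fermat step, p464601); (iii) ONE displayed
soft sentence, BOUNDARY AVOIDANCE: «no minimiser of (5) over the CLOSED class `closure 𝔘_k(L³B₃ε₁) ∩ 𝔅_k(V)` lies on the boundary — each lies in the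
OPEN class `𝔘_k(L³B₃ε₁)`».  The non-emptiness of each fibre is print's induction (Sect. A (11)–(13): the minimiser of (8) one level down, pushed up).

CONTENT.
* §1 one member: `exists_isBackground_of_avoidance` (a minimiser over the OPEN class `𝔘_k(e) ∩ 𝔅_k(V)` from the direct method + avoidance at `e`);
  `exists_isBackground8_of_prop8At` (… improved to the space (8) by Prop. 8's object sentence: interior minimiser ⇒ critical ⇒ in `𝔘_k(B₃ε₁)` ⇒ a
  minimiser over `𝔘_k(B₃ε₁) ∩ 𝔅_k(V)`).
* §2 one torus, all levels `k ≤ K` (`exists_isBackground_allLevels_of_prop8At_of_avoidance`): Prop. 8's object sentence and boundary avoidance at every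
  level `1 ≤ j ≤ K` (radius `L³B₃ε₁`, data with (7) at `ε₁ ≤ a₁`) ⇒ for every `k ≤ K` BOTH «a minimal orbit in `𝔘_k(L³B₃ε₁) ∩ 𝔅_k(V)`» (Prop. 7's second
  sentence with `O(1)C₁ = L³`) AND «a minimal orbit in the space (8)» (Theorem 1 (8)); `exists8_allLevels_of_prop8At_of_avoidance` (the socket form);
  `exists_isBackground_allLevels_of_prop8At_of_avoidanceAt` — the same with (P8)∕(AV) at ONE FIXED radius `ε₀` (print's (6)), `L³B₃a₁ ≤ ε₀ < α₀`.
* §3 ★★ at the crit-pinned residual layer `ζ.pinCrit` of record: `prop7Printed_pinCrit_of_atMostOne_prop8_avoidance` — `B11.Prop7Printed ζ.B₃ ζ.C₁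
  (famXOfRecord F N ζ.pinCrit)` ITSELF from its first (uniqueness) sentence, `p8 : B11.Prop8Printed ζ.B₃ (famXOfRecord F N ζ.pinCrit)` and boundary
  avoidance (`O₁ := L³∕C₁`, `a′₁ := min{a₁, a₅∕(L³B₃)}`); hence ★★★ `exists_thm1At_famV_pinCrit_of_atMostOne_prop8_sectF_avoidance` and
  `thm1Printed_Z11OfRecord_pinCrit_of_atMostOne_prop8_sectF_avoidance`: THEOREM 1 at one block of constants over the WHOLE Theorem-1 family of record
  from Prop. 7's uniqueness sentence + Prop. 8 + Sect. F + boundary avoidance — the existence sentence of Prop. 7 (and with it Props 4–6's contraction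
  and (142)) no longer displayed (g2's `exists_thm1At_famV_pinCrit_of_prop7_prop8_sectF` BY NAME); `b11Leaf_Z11OfRecord_pinCrit_of_parts_atMostOne_avoidance`
  (the [B11] LEAF of record at `ζ.pinCrit` from Props 2–6, 9 + the same four).

HONEST FRAMING.  Count-neutral kernel bookkeeping over the companion's direct method; NOTHING of [Balaban1985Variational] is asserted or proved: Prop. 7's
uniqueness sentence, Prop. 8, Sect. F stay DISPLAYED printed statements, and BOUNDARY AVOIDANCE is a displayed NON-PRINTED sentence (an L^∞ a-priori
property of closed-class minimisers — the located residue of D-B11-2 on the existence side, named here, not proved); N07 NOT discharged (5∕27 unmoved);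
one finite four-torus programme at fixed `ε = L^{−K}` — NOT the continuum limit, NOT ℝ⁴, NOT infinite volume, NOT OS, NOT a mass gap, NOT Clay.
-/

noncomputable section

namespace Summit.QuantumFields.YangMills.BalabanUVNodes.N07ExistenceFromProp8

open Set Filter Topology
open Literature.MathematicalPhysics.QuantumFieldTheory.Balaban1983to89
open Literature.MathematicalPhysics.QuantumFieldTheory.Balaban1983to89.T4Continuum (T4Family)
open Literature.MathematicalPhysics.QuantumFieldTheory.Balaban1983to89.Node00
open Literature.MathematicalPhysics.QuantumFieldTheory.Balaban1983to89.ExpMeanLog (deltaSU)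
open Literature.MathematicalPhysics.QuantumFieldTheory.Balaban1983to89.B12GaugeOrbits021 (OrbitRel)
open Literature.MathematicalPhysics.QuantumFieldTheory.Balaban1983to89.B11Thm1 (Thm1At Exists8)
open Literature.MathematicalPhysics.QuantumFieldTheory.Balaban1983to89.B11Thm1CarrierT (RegCarrierT varProblemT exists8_iff
  isBackground_of_subset_of_mem nonempty_regCarrierT)
open Literature.MathematicalPhysics.QuantumFieldTheory.Balaban1983to89.B11Thm1CarrierTLevelZero (inUkClassB11_mono)
open Literature.MathematicalPhysics.QuantumFieldTheory.Balaban1983to89.BlockAveragingSection (faceSec)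
open Summit.QuantumFields.YangMills.BalabanUVNodes.N07SectAObjects (inU_levelSucc iter_succ_of_iter_eq_faceSec plaqSmall_faceSec_record)
open Summit.QuantumFields.YangMills.BalabanUVNodes.N07DirectMethod (exists_isBackground_closure_inUkClassB11)
open Summit.QuantumFields.YangMills.BalabanUVNodes.N07DirectMethodInduction (isBackground_of_isBackground_closure_of_mem radius8_le_radius13)
open Literature.MathematicalPhysics.QuantumFieldTheory.Balaban1983to89.DagBinding (B11Leaf)
open Summit.QuantumFields.YangMills.BalabanUVNodes.N07AtRecordCritPinned (exists_thm1At_famV_pinCrit_of_prop7_prop8_sectF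
  thm1Printed_Z11OfRecord_pinCrit_of_prop7_prop8_sectF b11Leaf_Z11OfRecord_pinCrit_of_parts)
open scoped Matrix.Norms.L2Operator

variable {F : T4Family} {N : ℕ} [NeZero N]

/-! ## §1 One member: a minimal orbit in the open class from boundary avoidance; improved to (8) by Proposition 8 -/

/-- **A MINIMAL ORBIT IN THE OPEN CLASS `𝔘_k(e) ∩ 𝔅_k(V)` FROM THE DIRECT METHOD + BOUNDARY AVOIDANCE**: if the fibre is non-empty, `e < α₀` is
(53)-admissible, and no minimiser of (5) over the CLOSED class `closure 𝔘_k(e) ∩ 𝔅_k(V)` lies on the boundary (each lies in `𝔘_k(e)`), then (5) has a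
minimiser over `𝔘_k(e) ∩ 𝔅_k(V)` lying in it — Proposition 7's second sentence at radius `e`, in the reading of record.
[cite: Balaban1985Variational, Prop. 7 p.299 («there exists a minimal orbit in the space (6) with ε₀ = O(1)C₁B₃ε₁»)] -/
theorem exists_isBackground_of_avoidance (K k : ℕ) {e α₀ : ℝ} (he : e < α₀) (hα : 0 < α₀)
    (hα3 : (143 * (((((F.P K).d + 4 : ℕ) : ℝ)) ^ 2 / 4) ^ 2) * α₀ ≤ 1 / 3)
    (hα2 : 2 * α₀ ≤ 2 * deltaSU (Fin N) / ((((F.P K).d + 4) * (F.P K).L : ℕ) : ℝ) ^ 2)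
    {V : GaugeField (F.P K) k (SU N)} (hne : ∃ U, InUkClassB11 F N K k e U ∧ Averaging.iter (avOfRecord F N K) k U = V)
    (hav : ∀ U₀ : GaugeField (F.P K) 0 (SU N),
      IsBackground (avOfRecord F N K) (closure {U | InUkClassB11 F N K k e U}) k V U₀ → InUkClassB11 F N K k e U₀) :
    ∃ U₀ : GaugeField (F.P K) 0 (SU N), IsBackground (avOfRecord F N K) {U | InUkClassB11 F N K k e U} k V U₀ := by
  obtain ⟨U₀, h⟩ := exists_isBackground_closure_inUkClassB11 K k he hα hα3 hα2 hne
  exact ⟨U₀, isBackground_of_isBackground_closure_of_mem h (hav U₀ h)⟩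

/-- **… IMPROVED TO THE SPACE (8) BY PROPOSITION 8's OBJECT SENTENCE**: a minimiser over the open class `𝔘_k(e) ∩ 𝔅_k(V)` is CRITICAL (p464601's
Fermat step), so — if «every critical configuration of (5) on `𝔅_k(V)` in `𝔘_k(e)` lies in `𝔘_k(B₃ε₁)`» (Prop. 8 p. 304 at `ε₀ = e`) and `B₃ε₁ ≤ e` —
it minimises over the smaller space `𝔘_k(B₃ε₁) ∩ 𝔅_k(V)` and lies in it: «a minimal orbit in the space (8)».
[cite: Balaban1985Variational, Prop. 8 p.304, Thm 1 (8) p.279] -/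
theorem exists_isBackground8_of_prop8At (K k : ℕ) {B₃ ε₁ e : ℝ} (hB : B₃ * ε₁ ≤ e) {V : GaugeField (F.P K) k (SU N)}
    (hex : ∃ U₀ : GaugeField (F.P K) 0 (SU N), IsBackground (avOfRecord F N K) {U | InUkClassB11 F N K k e U} k V U₀)
    (hP8 : ∀ U : GaugeField (F.P K) 0 (SU N), InUkClassB11 F N K k e U → Averaging.iter (avOfRecord F N K) k U = V →
      IsCritOfRecord F N K k V U → InUkClassB11 F N K k (B₃ * ε₁) U) :
    ∃ U₀ : GaugeField (F.P K) 0 (SU N), IsBackground (avOfRecord F N K) {U | InUkClassB11 F N K k (B₃ * ε₁) U} k V U₀ := by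
  obtain ⟨U₀, h⟩ := hex
  exact ⟨U₀, isBackground_of_subset_of_mem h (fun _ hU => inUkClassB11_mono hB hU)
    (hP8 U₀ h.2.1 h.1 (isCritOfRecord_of_isBackground h))⟩

/-- The socket form: the same conclusion as `B11Thm1.Exists8 (varProblemT F N K k R) B₃ ε₁ V` (any regularity data `R`).
[cite: Balaban1985Variational, Thm 1 (8) p.279] -/
theorem exists8_of_prop8At (K k : ℕ) (R : RegCarrierT F N K) {B₃ ε₁ e : ℝ} (hB : B₃ * ε₁ ≤ e) {V : GaugeField (F.P K) k (SU N)}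
    (hex : ∃ U₀ : GaugeField (F.P K) 0 (SU N), IsBackground (avOfRecord F N K) {U | InUkClassB11 F N K k e U} k V U₀)
    (hP8 : ∀ U : GaugeField (F.P K) 0 (SU N), InUkClassB11 F N K k e U → Averaging.iter (avOfRecord F N K) k U = V →
      IsCritOfRecord F N K k V U → InUkClassB11 F N K k (B₃ * ε₁) U) :
    Exists8 (varProblemT F N K k R) B₃ ε₁ V :=
  (exists8_iff R B₃ ε₁ V).2 (exists_isBackground8_of_prop8At K k hB hex hP8)

/-! ## §2 One torus, all levels: print's induction with the direct method in place of Propositions 4–7 -/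

/-- **THE INDUCTIVE BACKGROUND (11)–(13) FROM A MINIMAL ORBIT IN (8) ONE LEVEL DOWN** (Sect. A at NODE 00's objects, this seat's p454423, in the
regularity-data-free currency): a minimiser of the level-`k` problem in `𝔘_k(B₃ε₁) ∩ 𝔅_k(V₀)`, `V₀ = faceSec V`, lies in
`𝔘_{k+1}(L³B₃ε₁) ∩ 𝔅_{k+1}(V)` (`B₃, ε₁ ≥ 0`, `k + 1 ≤ K`). [cite: Balaban1985Variational, (11)–(13) pp.279–280] -/
theorem exists_mem13_of_isBackground8 {K k : ℕ} (hk : k + 1 ≤ K) {B₃ ε₁ : ℝ} (hB₃ : 0 ≤ B₃) (hε₁ : 0 ≤ ε₁)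
    {V : GaugeField (F.P K) (k + 1) (SU N)}
    (h : ∃ U₀ : GaugeField (F.P K) 0 (SU N),
      IsBackground (avOfRecord F N K) {U | InUkClassB11 F N K k (B₃ * ε₁) U} k (faceSec V) U₀) :
    ∃ U₀ : GaugeField (F.P K) 0 (SU N),
      InUkClassB11 F N K (k + 1) ((F.L : ℝ) ^ 3 * B₃ * ε₁) U₀ ∧ Averaging.iter (avOfRecord F N K) (k + 1) U₀ = V := by
  obtain ⟨U₀, hU⟩ := h
  have R₀ : RegCarrierT F N K := (nonempty_regCarrierT (F := F) (N := N) K).some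
  have h13 := inU_levelSucc (k := k) R₀ R₀ (mul_nonneg hB₃ hε₁) (U := U₀) hU.2.1
  exact ⟨U₀, by rwa [← mul_assoc] at h13, iter_succ_of_iter_eq_faceSec hk hU.1⟩

/-- ★ **ALL LEVELS `k ≤ K` ON ONE TORUS.**  Fix `B₃ ≥ 7`, `a₁ > 0` with `L³B₃a₁ < α₀` (53)-admissible.  DISPLAYED at every level `1 ≤ j ≤ K`, for all data
`V` on `T^{(j)}` with (7) at `ε₁ ≤ a₁`: (P8) Proposition 8's object sentence at `ε₀ = L³B₃ε₁` — «critical configurations of (5) on `𝔅_j(V)` in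
`𝔘_j(L³B₃ε₁)` lie in `𝔘_j(B₃ε₁)`»; (AV) boundary avoidance — «minimisers of (5) over `closure 𝔘_j(L³B₃ε₁) ∩ 𝔅_j(V)` lie in `𝔘_j(L³B₃ε₁)`».  THEN for
every `k ≤ K` and such data: «a minimal orbit in `𝔘_k(L³B₃ε₁) ∩ 𝔅_k(V)`» (Prop. 7's second sentence, `O(1)C₁ = L³`) AND «a minimal orbit in the space
(8)» (Theorem 1 (8)).  Induction on `k`: level `0` — the datum itself (n07-a); level `k + 1` — (8) at level `k` for `V₀ = faceSec V` ⇒ the inductive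
background (11)–(13) ⇒ the fibre is inhabited ⇒ THE DIRECT METHOD + (AV) ⇒ a minimal orbit in `𝔘_{k+1}(L³B₃ε₁)` ⇒ (P8) ⇒ in (8).
[cite: Balaban1985Variational, Thm 1 (8) p.279, (11)–(13) pp.279–280, Prop. 7 p.299, Prop. 8 p.304] -/
theorem exists_isBackground_allLevels_of_prop8At_of_avoidance (K : ℕ) {B₃ a₁ α₀ : ℝ} (hB₃ : 7 ≤ B₃) (ha₁ : 0 < a₁)
    (he : (F.L : ℝ) ^ 3 * B₃ * a₁ < α₀) (hα : 0 < α₀)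
    (hα3 : (143 * (((((F.P K).d + 4 : ℕ) : ℝ)) ^ 2 / 4) ^ 2) * α₀ ≤ 1 / 3)
    (hα2 : 2 * α₀ ≤ 2 * deltaSU (Fin N) / ((((F.P K).d + 4) * (F.P K).L : ℕ) : ℝ) ^ 2)
    (hP8 : ∀ j : ℕ, 1 ≤ j → j ≤ K → ∀ ε₁ : ℝ, 0 < ε₁ → ε₁ ≤ a₁ → ∀ V : GaugeField (F.P K) j (SU N), PlaqSmall ε₁ V →
      ∀ U : GaugeField (F.P K) 0 (SU N), InUkClassB11 F N K j ((F.L : ℝ) ^ 3 * B₃ * ε₁) U → Averaging.iter (avOfRecord F N K) j U = V →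
        IsCritOfRecord F N K j V U → InUkClassB11 F N K j (B₃ * ε₁) U)
    (hav : ∀ j : ℕ, 1 ≤ j → j ≤ K → ∀ ε₁ : ℝ, 0 < ε₁ → ε₁ ≤ a₁ → ∀ V : GaugeField (F.P K) j (SU N), PlaqSmall ε₁ V →
      ∀ U₀ : GaugeField (F.P K) 0 (SU N),
        IsBackground (avOfRecord F N K) (closure {U | InUkClassB11 F N K j ((F.L : ℝ) ^ 3 * B₃ * ε₁) U}) j V U₀ →
          InUkClassB11 F N K j ((F.L : ℝ) ^ 3 * B₃ * ε₁) U₀) :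
    ∀ k : ℕ, k ≤ K → ∀ ε₁ : ℝ, 0 < ε₁ → ε₁ ≤ a₁ → ∀ V : GaugeField (F.P K) k (SU N), PlaqSmall ε₁ V →
      (∃ U₀ : GaugeField (F.P K) 0 (SU N), IsBackground (avOfRecord F N K) {U | InUkClassB11 F N K k ((F.L : ℝ) ^ 3 * B₃ * ε₁) U} k V U₀) ∧
      (∃ U₀ : GaugeField (F.P K) 0 (SU N), IsBackground (avOfRecord F N K) {U | InUkClassB11 F N K k (B₃ * ε₁) U} k V U₀)
  | 0, _, ε₁, hε₁, _, V, hV => by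
    have hB₃0 : 0 ≤ B₃ := by linarith
    have h7 : InUkClassB11 F N K 0 (7 * ε₁) V := B11Thm1LevelZero.inUkClassB11_zero_of_plaqSmall F N K hε₁ hV
    have h8 : InUkClassB11 F N K 0 (B₃ * ε₁) V := inUkClassB11_mono (mul_le_mul_of_nonneg_right hB₃ hε₁.le) h7
    have h13 : InUkClassB11 F N K 0 ((F.L : ℝ) ^ 3 * B₃ * ε₁) V := inUkClassB11_mono (radius8_le_radius13 (F := F) hB₃0 hε₁.le) h8
    exact ⟨⟨V, (B11Thm1LevelZero.isBackground_zero_iff _ _ V V).2 ⟨rfl, h13⟩⟩,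
      ⟨V, (B11Thm1LevelZero.isBackground_zero_iff _ _ V V).2 ⟨rfl, h8⟩⟩⟩
  | k + 1, hk, ε₁, hε₁, hε₁a, V, hV => by
    have hB₃0 : 0 ≤ B₃ := by linarith
    have hIH := (exists_isBackground_allLevels_of_prop8At_of_avoidance K hB₃ ha₁ he hα hα3 hα2 hP8 hav k (Nat.le_of_succ_le hk) ε₁ hε₁
      hε₁a (faceSec V) (plaqSmall_faceSec_record hk hε₁ hV)).2
    have hne := exists_mem13_of_isBackground8 hk hB₃0 hε₁.le hIH
    have he' : (F.L : ℝ) ^ 3 * B₃ * ε₁ < α₀ :=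
      (mul_le_mul_of_nonneg_left hε₁a (by positivity : (0 : ℝ) ≤ (F.L : ℝ) ^ 3 * B₃)).trans_lt he
    have hex := exists_isBackground_of_avoidance K (k + 1) he' hα hα3 hα2 hne (hav (k + 1) (Nat.succ_pos k) hk ε₁ hε₁ hε₁a V hV)
    exact ⟨hex, exists_isBackground8_of_prop8At K (k + 1) (radius8_le_radius13 (F := F) hB₃0 hε₁.le) hex
      (hP8 (k + 1) (Nat.succ_pos k) hk ε₁ hε₁ hε₁a V hV)⟩

/-- **The socket form of §2**: under (P8) and (AV) at every level of the `K`-th torus, `B11Thm1.Exists8 (varProblemT F N K k (R k)) B₃ ε₁ V` for every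
`k ≤ K`, `0 < ε₁ ≤ a₁`, `V` with (7), any regularity data `R`. [cite: Balaban1985Variational, Thm 1 (8) p.279] -/
theorem exists8_allLevels_of_prop8At_of_avoidance (K : ℕ) (R : ℕ → RegCarrierT F N K) {B₃ a₁ α₀ : ℝ} (hB₃ : 7 ≤ B₃) (ha₁ : 0 < a₁)
    (he : (F.L : ℝ) ^ 3 * B₃ * a₁ < α₀) (hα : 0 < α₀)
    (hα3 : (143 * (((((F.P K).d + 4 : ℕ) : ℝ)) ^ 2 / 4) ^ 2) * α₀ ≤ 1 / 3)
    (hα2 : 2 * α₀ ≤ 2 * deltaSU (Fin N) / ((((F.P K).d + 4) * (F.P K).L : ℕ) : ℝ) ^ 2)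
    (hP8 : ∀ j : ℕ, 1 ≤ j → j ≤ K → ∀ ε₁ : ℝ, 0 < ε₁ → ε₁ ≤ a₁ → ∀ V : GaugeField (F.P K) j (SU N), PlaqSmall ε₁ V →
      ∀ U : GaugeField (F.P K) 0 (SU N), InUkClassB11 F N K j ((F.L : ℝ) ^ 3 * B₃ * ε₁) U → Averaging.iter (avOfRecord F N K) j U = V →
        IsCritOfRecord F N K j V U → InUkClassB11 F N K j (B₃ * ε₁) U)
    (hav : ∀ j : ℕ, 1 ≤ j → j ≤ K → ∀ ε₁ : ℝ, 0 < ε₁ → ε₁ ≤ a₁ → ∀ V : GaugeField (F.P K) j (SU N), PlaqSmall ε₁ V →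
      ∀ U₀ : GaugeField (F.P K) 0 (SU N),
        IsBackground (avOfRecord F N K) (closure {U | InUkClassB11 F N K j ((F.L : ℝ) ^ 3 * B₃ * ε₁) U}) j V U₀ →
          InUkClassB11 F N K j ((F.L : ℝ) ^ 3 * B₃ * ε₁) U₀)
    {k : ℕ} (hk : k ≤ K) {ε₁ : ℝ} (hε₁ : 0 < ε₁) (hε₁a : ε₁ ≤ a₁) (V : GaugeField (F.P K) k (SU N)) (hV : PlaqSmall ε₁ V) :
    Exists8 (varProblemT F N K k (R k)) B₃ ε₁ V :=
  (exists8_iff (R k) B₃ ε₁ V).2 (exists_isBackground_allLevels_of_prop8At_of_avoidance K hB₃ ha₁ he hα hα3 hα2 hP8 hav k hk ε₁ hε₁ hε₁a V hV).2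

/-- ★ **THE SAME INDUCTION WITH BOUNDARY AVOIDANCE AT ONE FIXED RADIUS `ε₀`** (print's (6) with its own `ε₀`; `L³B₃a₁ ≤ ε₀ < α₀`): DISPLAYED at every
level `1 ≤ j ≤ K`, for data with (7) at `ε₁ ≤ a₁` — (P8) Prop. 8's object sentence at `ε₀` («critical configurations of (5) on `𝔅_j(V)` in `𝔘_j(ε₀)` lie
in `𝔘_j(B₃ε₁)`», in print for `ε₀ ≤ a₅`) and (AV) «minimisers of (5) over `closure 𝔘_j(ε₀) ∩ 𝔅_j(V)` lie in `𝔘_j(ε₀)`» (for `ε₁ ≪ ε₀` the soft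
statement «minimisers with nearly flat data stay strictly inside the fixed small-field region»).  THEN for every `k ≤ K`: a minimal orbit in
`𝔘_k(ε₀) ∩ 𝔅_k(V)` AND a minimal orbit in the space (8). [cite: Balaban1985Variational, (6), (8) p.278, Prop. 7 p.299, Prop. 8 p.304] -/
theorem exists_isBackground_allLevels_of_prop8At_of_avoidanceAt (K : ℕ) {B₃ a₁ ε₀ α₀ : ℝ} (hB₃ : 7 ≤ B₃) (ha₁ : 0 < a₁)
    (hε₀ : (F.L : ℝ) ^ 3 * B₃ * a₁ ≤ ε₀) (he : ε₀ < α₀) (hα : 0 < α₀)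
    (hα3 : (143 * (((((F.P K).d + 4 : ℕ) : ℝ)) ^ 2 / 4) ^ 2) * α₀ ≤ 1 / 3)
    (hα2 : 2 * α₀ ≤ 2 * deltaSU (Fin N) / ((((F.P K).d + 4) * (F.P K).L : ℕ) : ℝ) ^ 2)
    (hP8 : ∀ j : ℕ, 1 ≤ j → j ≤ K → ∀ ε₁ : ℝ, 0 < ε₁ → ε₁ ≤ a₁ → ∀ V : GaugeField (F.P K) j (SU N), PlaqSmall ε₁ V →
      ∀ U : GaugeField (F.P K) 0 (SU N), InUkClassB11 F N K j ε₀ U → Averaging.iter (avOfRecord F N K) j U = V →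
        IsCritOfRecord F N K j V U → InUkClassB11 F N K j (B₃ * ε₁) U)
    (hav : ∀ j : ℕ, 1 ≤ j → j ≤ K → ∀ ε₁ : ℝ, 0 < ε₁ → ε₁ ≤ a₁ → ∀ V : GaugeField (F.P K) j (SU N), PlaqSmall ε₁ V →
      ∀ U₀ : GaugeField (F.P K) 0 (SU N),
        IsBackground (avOfRecord F N K) (closure {U | InUkClassB11 F N K j ε₀ U}) j V U₀ → InUkClassB11 F N K j ε₀ U₀) :
    ∀ k : ℕ, k ≤ K → ∀ ε₁ : ℝ, 0 < ε₁ → ε₁ ≤ a₁ → ∀ V : GaugeField (F.P K) k (SU N), PlaqSmall ε₁ V →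
      (∃ U₀ : GaugeField (F.P K) 0 (SU N), IsBackground (avOfRecord F N K) {U | InUkClassB11 F N K k ε₀ U} k V U₀) ∧
      (∃ U₀ : GaugeField (F.P K) 0 (SU N), IsBackground (avOfRecord F N K) {U | InUkClassB11 F N K k (B₃ * ε₁) U} k V U₀)
  | 0, _, ε₁, hε₁, hε₁a, V, hV => by
    have hB₃0 : 0 ≤ B₃ := by linarith
    have h8 : InUkClassB11 F N K 0 (B₃ * ε₁) V :=
      inUkClassB11_mono (mul_le_mul_of_nonneg_right hB₃ hε₁.le) (B11Thm1LevelZero.inUkClassB11_zero_of_plaqSmall F N K hε₁ hV)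
    have hle : B₃ * ε₁ ≤ ε₀ := ((radius8_le_radius13 (F := F) hB₃0 hε₁.le).trans
      (mul_le_mul_of_nonneg_left hε₁a (by positivity : (0 : ℝ) ≤ (F.L : ℝ) ^ 3 * B₃))).trans hε₀
    exact ⟨⟨V, (B11Thm1LevelZero.isBackground_zero_iff _ _ V V).2 ⟨rfl, inUkClassB11_mono hle h8⟩⟩,
      ⟨V, (B11Thm1LevelZero.isBackground_zero_iff _ _ V V).2 ⟨rfl, h8⟩⟩⟩
  | k + 1, hk, ε₁, hε₁, hε₁a, V, hV => by
    have hB₃0 : 0 ≤ B₃ := by linarith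
    have hIH := (exists_isBackground_allLevels_of_prop8At_of_avoidanceAt K hB₃ ha₁ hε₀ he hα hα3 hα2 hP8 hav k (Nat.le_of_succ_le hk) ε₁
      hε₁ hε₁a (faceSec V) (plaqSmall_faceSec_record hk hε₁ hV)).2
    obtain ⟨U₀, hU, hUV⟩ := exists_mem13_of_isBackground8 hk hB₃0 hε₁.le hIH
    have hle : (F.L : ℝ) ^ 3 * B₃ * ε₁ ≤ ε₀ :=
      (mul_le_mul_of_nonneg_left hε₁a (by positivity : (0 : ℝ) ≤ (F.L : ℝ) ^ 3 * B₃)).trans hε₀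
    have hex := exists_isBackground_of_avoidance K (k + 1) he hα hα3 hα2 ⟨U₀, inUkClassB11_mono hle hU, hUV⟩
      (hav (k + 1) (Nat.succ_pos k) hk ε₁ hε₁ hε₁a V hV)
    exact ⟨hex, exists_isBackground8_of_prop8At K (k + 1) ((radius8_le_radius13 (F := F) hB₃0 hε₁.le).trans hle) hex
      (hP8 (k + 1) (Nat.succ_pos k) hk ε₁ hε₁ hε₁a V hV)⟩

/-! ## §3 At the crit-pinned residual layer of record: Proposition 7 itself, hence Theorem 1, without Proposition 7's existence sentence -/
/-! ## §3 At the crit-pinned residual layer of record: Proposition 7 itself, hence Theorem 1, without Proposition 7's existence sentence -/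

section AtPin

variable (ζ : ResidZ F N)

/-- ★★ **PROPOSITION 7 AT `ζ.pinCrit` FROM ITS UNIQUENESS SENTENCE, PROPOSITION 8 AND BOUNDARY AVOIDANCE.**  DISPLAYED: (U7) Prop. 7's first sentence as
the typed `AtMostOneCriticalOrbit` of the family of record at every member (print's, proved in print by Props 4–6); (p8) `B11.Prop8Printed ζ.B₃
(famXOfRecord F N ζ.pinCrit)` (print's, proved in print by Sect. F; at the pin «critical» = `IsCritOfRecord`, p465289's `famXOfRecord_pinCrit_isCritical_iff`);
(AV) boundary avoidance at radius `L³B₃ε₁` for data with (7) at `ε₁ ≤ a₁`, every member; and the (53)-admissible `α₀` with `L³B₃a₁ < α₀` (`B₃ ≥ 7`,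
`C₁ > 0`).  CONCLUSION: the WHOLE of `B11.Prop7Printed ζ.B₃ ζ.C₁ (famXOfRecord F N ζ.pinCrit)` — its existence sentence supplied by §2 with
`O₁ := L³∕C₁` and `a′₁ := min{a₁, a₅∕(L³B₃)}`. [cite: Balaban1985Variational, Prop. 7 p.299, Prop. 8 p.304, (13) p.280] -/
theorem prop7Printed_pinCrit_of_atMostOne_prop8_avoidance (hB₃ : 7 ≤ ζ.B₃) (hC₁ : 0 < ζ.C₁) {a₀ a₁ α₀ : ℝ} (ha₀ : 0 < a₀) (ha₁ : 0 < a₁)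
    (he : (F.L : ℝ) ^ 3 * ζ.B₃ * a₁ < α₀) (hα : 0 < α₀)
    (hα3 : (143 * ((((4 + 4 : ℕ) : ℝ)) ^ 2 / 4) ^ 2) * α₀ ≤ 1 / 3)
    (hα2 : 2 * α₀ ≤ 2 * deltaSU (Fin N) / (((4 + 4) * F.L : ℕ) : ℝ) ^ 2)
    (huniq : ∀ (i : ZIdx) (ε₀ ε₁ : ℝ), 0 < ε₁ → ∀ V : GaugeField (F.P i.K) i.k (SU N), PlaqSmall ε₁ V → ε₀ ≤ a₀ → ζ.B₃ * ε₁ ≤ ε₀ →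
      (famXOfRecord F N ζ.pinCrit i).AtMostOneCriticalOrbit ε₀ V)
    (p8 : B11.Prop8Printed ζ.B₃ (famXOfRecord F N ζ.pinCrit))
    (hav : ∀ (i : ZIdx) (ε₁ : ℝ), 0 < ε₁ → ε₁ ≤ a₁ → ∀ V : GaugeField (F.P i.K) i.k (SU N), PlaqSmall ε₁ V →
      ∀ U₀ : GaugeField (F.P i.K) 0 (SU N),
        IsBackground (avOfRecord F N i.K) (closure {U | InUkClassB11 F N i.K i.k ((F.L : ℝ) ^ 3 * ζ.B₃ * ε₁) U}) i.k V U₀ →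
          InUkClassB11 F N i.K i.k ((F.L : ℝ) ^ 3 * ζ.B₃ * ε₁) U₀) :
    B11.Prop7Printed ζ.B₃ ζ.C₁ (famXOfRecord F N ζ.pinCrit) := by
  obtain ⟨a₅, ha₅, H8⟩ := p8
  have hB₃0 : 0 < ζ.B₃ := by linarith
  have hL3 : (0 : ℝ) < (F.L : ℝ) ^ 3 := by
    have : (0 : ℝ) < (F.L : ℝ) := by exact_mod_cast (zero_lt_one.trans F.hL.2)
    positivity
  set a₁' : ℝ := min a₁ (a₅ / ((F.L : ℝ) ^ 3 * ζ.B₃)) with ha₁'_def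
  have ha₁' : 0 < a₁' := lt_min ha₁ (div_pos ha₅ (mul_pos hL3 hB₃0))
  refine ⟨a₀, a₁', (F.L : ℝ) ^ 3 / ζ.C₁, ha₀, ha₁', div_pos hL3 hC₁, fun i ε₀ ε₁ hε₁ V hV => ⟨huniq i ε₀ ε₁ hε₁ V hV, fun hε₁a' => ?_⟩⟩
  -- the existence sentence at member `i = ⟨K, k⟩`, radius `O₁C₁B₃ε₁ = L³B₃ε₁`
  have hε₁a : ε₁ ≤ a₁' := hε₁a'
  have hε₁a₁ : ε₁ ≤ a₁ := hε₁a.trans (min_le_left _ _)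
  have hrad : (F.L : ℝ) ^ 3 / ζ.C₁ * ζ.C₁ * ζ.B₃ * ε₁ = (F.L : ℝ) ^ 3 * ζ.B₃ * ε₁ := by
    field_simp
  show ∃ U : GaugeField (F.P i.K) 0 (SU N),
    IsBackground (avOfRecord F N i.K) {U | InUkClassB11 F N i.K i.k ((F.L : ℝ) ^ 3 / ζ.C₁ * ζ.C₁ * ζ.B₃ * ε₁) U} i.k V U
  rw [hrad]
  -- Prop. 8's object sentence on the `i.K`-th torus at radius `L³B₃ε₁` (needs `L³B₃ε₁ ≤ a₅`, i.e. `ε₁ ≤ a₅/(L³B₃)`), restricted to `ε₁ ≤ a₁'`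
  have hP8 : ∀ j : ℕ, 1 ≤ j → j ≤ i.K → ∀ ε₁ : ℝ, 0 < ε₁ → ε₁ ≤ a₁' → ∀ V : GaugeField (F.P i.K) j (SU N), PlaqSmall ε₁ V →
      ∀ U : GaugeField (F.P i.K) 0 (SU N), InUkClassB11 F N i.K j ((F.L : ℝ) ^ 3 * ζ.B₃ * ε₁) U →
        Averaging.iter (avOfRecord F N i.K) j U = V → IsCritOfRecord F N i.K j V U → InUkClassB11 F N i.K j (ζ.B₃ * ε₁) U := by
    intro j _ hj ε₁ hε₁ hε₁a V hV U hU hUV hcrit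
    have hε₀ : (F.L : ℝ) ^ 3 * ζ.B₃ * ε₁ ≤ a₅ := by
      have h1 : ε₁ ≤ a₅ / ((F.L : ℝ) ^ 3 * ζ.B₃) := hε₁a.trans (min_le_right _ _)
      rw [le_div_iff₀ (mul_pos hL3 hB₃0)] at h1
      linarith
    exact H8 ⟨i.K, j, hj⟩ ((F.L : ℝ) ^ 3 * ζ.B₃ * ε₁) ε₁ hε₁ V U hV hU hUV hcrit hε₀
  have hav' : ∀ j : ℕ, 1 ≤ j → j ≤ i.K → ∀ ε₁ : ℝ, 0 < ε₁ → ε₁ ≤ a₁' → ∀ V : GaugeField (F.P i.K) j (SU N), PlaqSmall ε₁ V →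
      ∀ U₀ : GaugeField (F.P i.K) 0 (SU N),
        IsBackground (avOfRecord F N i.K) (closure {U | InUkClassB11 F N i.K j ((F.L : ℝ) ^ 3 * ζ.B₃ * ε₁) U}) j V U₀ →
          InUkClassB11 F N i.K j ((F.L : ℝ) ^ 3 * ζ.B₃ * ε₁) U₀ :=
    fun j _ hj ε₁ hε₁ hε₁a V hV U₀ hU₀ => hav ⟨i.K, j, hj⟩ ε₁ hε₁ (hε₁a.trans (min_le_left _ _)) V hV U₀ hU₀
  have he' : (F.L : ℝ) ^ 3 * ζ.B₃ * a₁' < α₀ :=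
    (mul_le_mul_of_nonneg_left (min_le_left _ _) (by positivity : (0 : ℝ) ≤ (F.L : ℝ) ^ 3 * ζ.B₃)).trans_lt he
  have hα3K : (143 * (((((F.P i.K).d + 4 : ℕ) : ℝ)) ^ 2 / 4) ^ 2) * α₀ ≤ 1 / 3 := by
    rw [T4Family.P_d]; exact hα3
  have hα2K : 2 * α₀ ≤ 2 * deltaSU (Fin N) / ((((F.P i.K).d + 4) * (F.P i.K).L : ℕ) : ℝ) ^ 2 := by
    rw [T4Family.P_d, T4Family.P_L]; exact hα2
  exact (exists_isBackground_allLevels_of_prop8At_of_avoidance i.K hB₃ ha₁' he' hα hα3K hα2K hP8 hav' i.k i.hk ε₁ hε₁ hε₁a V hV).1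

/-- ★★★ **THEOREM 1 AT ONE BLOCK OF CONSTANTS OVER THE WHOLE THEOREM-1 FAMILY OF RECORD ⇐ PROP. 7's UNIQUENESS SENTENCE, PROP. 8, SECT. F AND BOUNDARY
AVOIDANCE** — g2's `exists_thm1At_famV_pinCrit_of_prop7_prop8_sectF` (p465289; p. 304's assembly at NODE 00's objects, no `hloc`, no `hcrit`) fed with
§3's Proposition 7.  Proposition 7's existence sentence — and with it Propositions 4–6 (the contraction for (111)) and the local-minimum argument (142) in
the global reading of record (D-B11-2) — is NO LONGER DISPLAYED: the direct method (companion) and the one soft sentence (AV) replace it.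
[cite: Balaban1985Variational, Thm 1 p.279, Prop. 7 p.299, Prop. 8 p.304, p.304 («Now we define a₁ …»), Sect. F (169) p.305] -/
theorem exists_thm1At_famV_pinCrit_of_atMostOne_prop8_sectF_avoidance (hB₃ : 7 ≤ ζ.B₃) (hC₁ : 0 < ζ.C₁) {a₀ a₁ α₀ : ℝ}
    (ha₀ : 0 < a₀) (ha₁ : 0 < a₁) (he : (F.L : ℝ) ^ 3 * ζ.B₃ * a₁ < α₀) (hα : 0 < α₀)
    (hα3 : (143 * ((((4 + 4 : ℕ) : ℝ)) ^ 2 / 4) ^ 2) * α₀ ≤ 1 / 3)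
    (hα2 : 2 * α₀ ≤ 2 * deltaSU (Fin N) / (((4 + 4) * F.L : ℕ) : ℝ) ^ 2)
    (huniq : ∀ (i : ZIdx) (ε₀ ε₁ : ℝ), 0 < ε₁ → ∀ V : GaugeField (F.P i.K) i.k (SU N), PlaqSmall ε₁ V → ε₀ ≤ a₀ → ζ.B₃ * ε₁ ≤ ε₀ →
      (famXOfRecord F N ζ.pinCrit i).AtMostOneCriticalOrbit ε₀ V)
    (p8 : B11.Prop8Printed ζ.B₃ (famXOfRecord F N ζ.pinCrit)) (sF : B11.SectFPrinted ζ.B₃ (famXOfRecord F N ζ.pinCrit))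
    (hav : ∀ (i : ZIdx) (ε₁ : ℝ), 0 < ε₁ → ε₁ ≤ a₁ → ∀ V : GaugeField (F.P i.K) i.k (SU N), PlaqSmall ε₁ V →
      ∀ U₀ : GaugeField (F.P i.K) 0 (SU N),
        IsBackground (avOfRecord F N i.K) (closure {U | InUkClassB11 F N i.K i.k ((F.L : ℝ) ^ 3 * ζ.B₃ * ε₁) U}) i.k V U₀ →
          InUkClassB11 F N i.K i.k ((F.L : ℝ) ^ 3 * ζ.B₃ * ε₁) U₀) :
    ∃ C : B11Thm1.Consts, C.B₃ = ζ.B₃ ∧ ∀ i : ZIdx, Thm1At C (famVOfRecord F N ζ i) :=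
  exists_thm1At_famV_pinCrit_of_prop7_prop8_sectF ζ (by linarith) hC₁
    (prop7Printed_pinCrit_of_atMostOne_prop8_avoidance ζ hB₃ hC₁ ha₀ ha₁ he hα hα3 hα2 huniq p8 hav) p8 sF

/-- **`Thm1Printed` OVER THE [B11] BUNDLE OF RECORD** from the same four displayed statements (g2's `thm1Printed_Z11OfRecord_pinCrit_of_prop7_prop8_sectF`
BY NAME). [cite: Balaban1985Variational, Thm 1 p.279, Prop. 7 p.299, Prop. 8 p.304, Sect. F (169) p.305] -/
theorem thm1Printed_Z11OfRecord_pinCrit_of_atMostOne_prop8_sectF_avoidance (hB₃ : 7 ≤ ζ.B₃) (hC₁ : 0 < ζ.C₁) {a₀ a₁ α₀ : ℝ}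
    (ha₀ : 0 < a₀) (ha₁ : 0 < a₁) (he : (F.L : ℝ) ^ 3 * ζ.B₃ * a₁ < α₀) (hα : 0 < α₀)
    (hα3 : (143 * ((((4 + 4 : ℕ) : ℝ)) ^ 2 / 4) ^ 2) * α₀ ≤ 1 / 3)
    (hα2 : 2 * α₀ ≤ 2 * deltaSU (Fin N) / (((4 + 4) * F.L : ℕ) : ℝ) ^ 2)
    (huniq : ∀ (i : ZIdx) (ε₀ ε₁ : ℝ), 0 < ε₁ → ∀ V : GaugeField (F.P i.K) i.k (SU N), PlaqSmall ε₁ V → ε₀ ≤ a₀ → ζ.B₃ * ε₁ ≤ ε₀ →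
      (famXOfRecord F N ζ.pinCrit i).AtMostOneCriticalOrbit ε₀ V)
    (p8 : B11.Prop8Printed ζ.B₃ (famXOfRecord F N ζ.pinCrit)) (sF : B11.SectFPrinted ζ.B₃ (famXOfRecord F N ζ.pinCrit))
    (hav : ∀ (i : ZIdx) (ε₁ : ℝ), 0 < ε₁ → ε₁ ≤ a₁ → ∀ V : GaugeField (F.P i.K) i.k (SU N), PlaqSmall ε₁ V →
      ∀ U₀ : GaugeField (F.P i.K) 0 (SU N),
        IsBackground (avOfRecord F N i.K) (closure {U | InUkClassB11 F N i.K i.k ((F.L : ℝ) ^ 3 * ζ.B₃ * ε₁) U}) i.k V U₀ →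
          InUkClassB11 F N i.K i.k ((F.L : ℝ) ^ 3 * ζ.B₃ * ε₁) U₀) :
    B11.Thm1Printed (Z11OfRecord F N ζ.pinCrit).famV :=
  thm1Printed_Z11OfRecord_pinCrit_of_prop7_prop8_sectF ζ (by linarith) hC₁
    (prop7Printed_pinCrit_of_atMostOne_prop8_avoidance ζ hB₃ hC₁ ha₀ ha₁ he hα hα3 hα2 huniq p8 hav) p8 sF

/-- **THE [B11] LEAF OF RECORD AT `ζ.pinCrit` (`DagBinding.B11Leaf`, hence N07's node sentence at every record key by the closers of record) from Props
2–6 and 9, Prop. 7's UNIQUENESS sentence, Prop. 8, Sect. F and boundary avoidance** — g2's `b11Leaf_Z11OfRecord_pinCrit_of_parts` (p465289; no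
`hloc`, no `hcrit`) fed with §3's Proposition 7; at the doubly∕fully presented layers `p4`, `p6`, `p9` are theorems of record (p462651, p477837), so
there the displayed printed set is {Props 2, 3, 5, Prop. 7 (uniqueness), Prop. 8, Sect. F} + boundary avoidance.
[cite: Balaban1985Variational, Thm 1 p.279, Props 2–9 pp.281–309] -/
theorem b11Leaf_Z11OfRecord_pinCrit_of_parts_atMostOne_avoidance (hB₃ : 7 ≤ ζ.B₃) (hC₁ : 0 < ζ.C₁) {a₀ a₁ α₀ : ℝ}
    (ha₀ : 0 < a₀) (ha₁ : 0 < a₁) (he : (F.L : ℝ) ^ 3 * ζ.B₃ * a₁ < α₀) (hα : 0 < α₀)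
    (hα3 : (143 * ((((4 + 4 : ℕ) : ℝ)) ^ 2 / 4) ^ 2) * α₀ ≤ 1 / 3)
    (hα2 : 2 * α₀ ≤ 2 * deltaSU (Fin N) / (((4 + 4) * F.L : ℕ) : ℝ) ^ 2)
    (p2 : B11.Prop2Printed ζ.B₁ ζ.B₃ ζ.C₁ ζ.c₁ ζ.famLG) (p3 : B11.Prop3Printed ζ.C₁ ζ.B₃ ζ.C₂ ζ.C₃ ζ.B₀ ζ.c1h ζ.c₄ ζ.δ₀ ζ.famLG)
    (p4 : B11.Prop4Printed ζ.C₁ ζ.B₃ ζ.famLG) (p5 : B11.Prop5Printed ζ.B₁ ζ.B₃ ζ.C₁ ζ.famLG) (p6 : B11.Prop6Printed ζ.B₀ ζ.B₃ ζ.C₁ ζ.famLG)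
    (huniq : ∀ (i : ZIdx) (ε₀ ε₁ : ℝ), 0 < ε₁ → ∀ V : GaugeField (F.P i.K) i.k (SU N), PlaqSmall ε₁ V → ε₀ ≤ a₀ → ζ.B₃ * ε₁ ≤ ε₀ →
      (famXOfRecord F N ζ.pinCrit i).AtMostOneCriticalOrbit ε₀ V)
    (p8 : B11.Prop8Printed ζ.B₃ (famXOfRecord F N ζ.pinCrit)) (sF : B11.SectFPrinted ζ.B₃ (famXOfRecord F N ζ.pinCrit))
    (p9 : B11.Prop9Printed ζ.B₅ ζ.C₁ ζ.β₀ ζ.δ₀ ζ.famAn)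
    (hav : ∀ (i : ZIdx) (ε₁ : ℝ), 0 < ε₁ → ε₁ ≤ a₁ → ∀ V : GaugeField (F.P i.K) i.k (SU N), PlaqSmall ε₁ V →
      ∀ U₀ : GaugeField (F.P i.K) 0 (SU N),
        IsBackground (avOfRecord F N i.K) (closure {U | InUkClassB11 F N i.K i.k ((F.L : ℝ) ^ 3 * ζ.B₃ * ε₁) U}) i.k V U₀ →
          InUkClassB11 F N i.K i.k ((F.L : ℝ) ^ 3 * ζ.B₃ * ε₁) U₀) :
    B11Leaf (Z11OfRecord F N ζ.pinCrit) :=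
  b11Leaf_Z11OfRecord_pinCrit_of_parts ζ (by linarith) hC₁ p2 p3 p4 p5 p6
    (prop7Printed_pinCrit_of_atMostOne_prop8_avoidance ζ hB₃ hC₁ ha₀ ha₁ he hα hα3 hα2 huniq p8 hav) p8 sF p9

end AtPin

end Summit.QuantumFields.YangMills.BalabanUVNodes.N07ExistenceFromProp8

end
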